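import Summits.ResolutionOfSingularities.ResolutionOfSingularities.Theorems.EquisingularLiftEquisingularLiftNatResidueHypDefsE8
import Summits.ResolutionOfSingularities.ResolutionOfSingularities.Theorems.EquisingularLiftEquisingularLiftNatModelTraceEmbDim
import Summits.ResolutionOfSingularities.ResolutionOfSingularities.Theorems.EquisingularLiftEquisingularLiftNatModelStep
import Summits.ResolutionOfSingularities.ResolutionOfSingularities.Theorems.EquisingularLiftEquisingularLiftWittRing
import Summits.ResolutionOfSingularities.ResolutionOfSingularities.Theorems.EquisingularLiftEquisingularLiftGoodAtOfSmooth
import Summits.ResolutionOfSingularities.ResolutionOfSingularities.Theorems.EquisingularLiftEquisingularLiftProjectiveAmbientSmoothProper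
import Summits.ResolutionOfSingularities.ResolutionOfSingularities.Theorems.EquisingularLiftEquisingularLiftProjectiveAmbientFibre
import Literature.AlgebraicGeometry.Resolution.BlowupsExistence
import HarnessLib

/-!
# [OURS · L1 W4.5(b) · EL♮(3) · WIDTH TABLE D15 «ν-LIFT DOOR», NEGATIVE SIDE] THE EMBEDDING-DIMENSION OBSTRUCTION TO THE ν-LIFT SLOT, IN THE KERNEL:
# `LiftNose.noseLift₀_false_of_lt_spanFinrank` — a point of the strict transform `Z₂` with `dim 𝒪_{Z̃₂,z} + 1 < μ(𝔪_{Z̃₂,z})` ⇒ `¬ NoseLift₀ k 3 H ι Z hZ S hS`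

res-L1-w45b-nose-w1 g7 (WIDTH seat D-0157 DOOR 1; memo `NU-LIFT-OBSTRUCTION-nose-w1.md` 2f087d691d1f1f28 §2–§3, desk BOOKING R78e (1) «the νLIFT
non-membership test», panel CONCUR ×3).  The by-hand lemma of the memo («a regular `O`-flat `C` with exact REDUCED trace `Z̃₂` forces `μ(𝔪_{Z̃₂,z}) ≤
dim + 1` at every point — so an embedding-dimension-3 curve point admits none, over ANY `O`») is ALREADY a kernel fact of this tree: ✓
`ModelSquare.not_exists_regular_flat_model_of_lt_spanFinrank` (…NatModelTraceEmbDim, res-L1-w45b-nose-w1 g6, p703581).  This module aims it at the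
D15 slot `NoseLift₀` (res-type-027 ✓ …NatResidueHypDefsE8): since the slot quantifies over EVERY admissible `(O, θ, φ)`, EVERY blow-up `X₁` of its
sections and EVERY downstairs blow-up `F₂` of `S` with a model square, ONE admissible base (the Witt ring, ✓ `stub_wittRing`), ONE graded lift
(`MvPolynomial.map`), the blow-ups (Literature ✓ `exists_isBlowup`) and the model square of ✓ `modelStep` suffice to extract a centre `C` that the g6
no-go forbids.  The obstruction hypothesis is stated for EVERY downstairs blow-up of `𝓘⟨S⟩` (they are isomorphic; the customer certifies the germ once).
OURS; NOT a statement of any manuscript ([Hironaka2017] is a candidate under adjudication, nothing of it is asserted); AI-written, weaker than expert review.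
DEF-FREE; no `sorry`; standard axioms.  `--kind proof --supports stmt-ResolutionOfSingularities-20148 --as helper`, counted 0.  EL♮(3) is NOT proved here
(negative-side / census lemma: it certifies NON-membership in the νLIFT disjunct, not a failure of EL♮(3)); resolution in char p NOT proved.
[cite: Matsumura1987, Thm. 14.2] [folklore]
-/

set_option linter.dupNamespace false -- mandated namespace `Summit.<Summit>.<Problem>` of this single-conjunct summit

noncomputable section

open CategoryTheory CategoryTheory.Limits AlgebraicGeometry TopologicalSpace Topology IsLocalRing
open MvPolynomial
open Literature.AlgebraicGeometry.Resolution
open AlgebraicGeometry.Scheme.IdealSheafData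
open Summit.ResolutionOfSingularities.ResolutionOfSingularities.Cruxes.EquisingularLift.StrataSplit

namespace Summit.ResolutionOfSingularities.ResolutionOfSingularities.Cruxes.EquisingularLiftNat.Sections.LiftNose

/-- ★ **THE ν-LIFT SLOT FAILS AT AN EMBEDDING-DIMENSION OBSTRUCTED STRICT TRANSFORM** (memo §2–§3 in the kernel): over an algebraically closed `k`
of characteristic `p > 0`, if for EVERY blow-up `υ : F₂ ⟶ ℙ³_k` of `𝓘⟨S⟩` the reduced strict transform `Z̃₂ = redSub F₂ (closure υ⁻¹(Z ∖ S))` has a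
point `z` with `dim 𝒪_{Z̃₂,z} + 1 < μ(𝔪_{Z̃₂,z})` (e.g. a closed curve point of embedding dimension 3), then `¬ NoseLift₀ k 3 H ι Z hZ S hS`.
Witness base: the Witt ring of `k` (✓ `stub_wittRing`); graded lift `MvPolynomial.map`; model square by ✓ `modelStep` with the trivial chain predicate;
contradiction by ✓ `ModelSquare.not_exists_regular_flat_model_of_lt_spanFinrank`. [OURS · negative-side census lemma; counted 0; EL♮(3) NOT proved] -/
theorem noseLift₀_false_of_lt_spanFinrank (p : ℕ) (hp : p.Prime) (k : Type) [Field k] [CharP k p] [IsAlgClosed k]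
    (H : AlgebraicGeometry.Scheme.{0}) (ι : H ⟶ (Literature.AlgebraicGeometry.Motives.projectiveSpace 3 k).left)
    (Z : Set (Literature.AlgebraicGeometry.Motives.projectiveSpace 3 k).left) (hZ : IsClosed Z)
    (S : Set (Literature.AlgebraicGeometry.Motives.projectiveSpace 3 k).left) (hS : IsClosed S)
    (hedim : ∀ (F₂ : Scheme.{0}) (υ : F₂ ⟶ (Literature.AlgebraicGeometry.Motives.projectiveSpace 3 k).left),
      IsBlowup υ (vanishingIdeal (⟨S, hS⟩ : Closeds (Literature.AlgebraicGeometry.Motives.projectiveSpace 3 k).left)) →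
      ∃ z : ↥(redSub F₂ (closure (υ ⁻¹' (Z \ S))) isClosed_closure),
        ringKrullDim ((redSub F₂ (closure (υ ⁻¹' (Z \ S))) isClosed_closure).presheaf.stalk z) + 1 <
          (((maximalIdeal ((redSub F₂ (closure (υ ⁻¹' (Z \ S))) isClosed_closure).presheaf.stalk z)).spanFinrank : ℕ∞) : WithBot ℕ∞)) :
    ¬ NoseLift₀ k 3 H ι Z hZ S hS := by
  classical
  intro hL
  -- ONE admissible base: the Witt ring of `k`, with its graded coefficient map
  obtain ⟨O, i1, i2, i3, _, i5, i6, π, hπ⟩ := stub_wittRing p hp k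
  letI := MvPolynomial.gradedAlgebra (σ := Fin (3 + 1)) (R := O)
  letI := MvPolynomial.gradedAlgebra (σ := Fin (3 + 1)) (R := k)
  let φ : homogeneousSubmodule (Fin (3 + 1)) O →+*ᵍ homogeneousSubmodule (Fin (3 + 1)) k := ⟨MvPolynomial.map π, fun h ↦ h.map π⟩
  have hφ : ∀ s, φ s = MvPolynomial.map π s := fun _ ↦ rfl
  have hφ' := ProjectiveAmbientFibre.irrelevant_le_map_gradedMap π φ hφ
  -- the slot at `(O, π, φ)`: the sections `𝓢` and the centre promise
  obtain ⟨𝓢, h𝓢reg, h𝓢fl, h𝓢tr, -, hC⟩ := hL O π hπ φ hφ' hφ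
  -- the ambient `ℙ³_O → Spec O`: smooth, hence locally Noetherian and regular
  set q : Proj (homogeneousSubmodule (Fin (3 + 1)) O) ⟶ Spec (.of O) :=
    Proj.toSpecZero (homogeneousSubmodule (Fin (3 + 1)) O) ≫
      Spec.map (CommRingCat.ofHom (algebraMap O (homogeneousSubmodule (Fin (3 + 1)) O 0))) with hq
  obtain ⟨hsm, -⟩ := stub_projectiveAmbientSmoothProper O 3
  haveI : Smooth q := hsm
  haveI hPnoeth : IsLocallyNoetherian (Proj (homogeneousSubmodule (Fin (3 + 1)) O)) := LocallyOfFiniteType.isLocallyNoetherian q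
  have hPreg : Scheme.IsRegular (Proj (homogeneousSubmodule (Fin (3 + 1)) O)) := fun y => (stub_goodAtOfSmooth O _ q hsm y).1
  -- the base model square `Proj φ : ℙ³_k → ℙ³_O` over `Spec π`
  have hP := ProjectiveAmbientFibre.isPullback_projMap π φ hφ hπ hφ'
  have hsq₀ : IsPullback (Proj.map φ hφ') (Proj.toSpecZero (homogeneousSubmodule (Fin (3 + 1)) k) ≫
      Spec.map (CommRingCat.ofHom (algebraMap k (homogeneousSubmodule (Fin (3 + 1)) k 0))))
      (𝟙 _ ≫ q) (Spec.map (CommRingCat.ofHom π)) := by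
    rw [Category.id_comp]; exact hP
  -- the two blow-ups: of the sections upstairs, of `𝓘⟨S⟩` downstairs
  obtain ⟨X₁, τ, hτ⟩ := exists_isBlowup (Proj (homogeneousSubmodule (Fin (3 + 1)) O)) 𝓢
  obtain ⟨F₂, υ, hυ⟩ := exists_isBlowup (Literature.AlgebraicGeometry.Motives.projectiveSpace 3 k).left
    (vanishingIdeal (⟨S, hS⟩ : Closeds (Literature.AlgebraicGeometry.Motives.projectiveSpace 3 k).left))
  -- the model square of the blow-up (✓ `modelStep`, trivial chain predicate, `Y := ∅`)
  have hfl' : Flat (𝓢.subschemeι ≫ 𝟙 (Proj (homogeneousSubmodule (Fin (3 + 1)) O)) ≫ q) := by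
    rw [Category.id_comp]; exact h𝓢fl
  have hoff : (𝟙 (Proj (homogeneousSubmodule (Fin (3 + 1)) O)) : _ ⟶ _) '' (𝓢.support : Set (Proj (homogeneousSubmodule (Fin (3 + 1)) O))) ⊆
      {x | ¬ IsGenericPoint x (∅ : Set (Proj (homogeneousSubmodule (Fin (3 + 1)) O)))} := by
    intro x _ hgen
    have h1 : x ∈ (∅ : Set (Proj (homogeneousSubmodule (Fin (3 + 1)) O))) := hgen.mem
    exact h1
  obtain ⟨-, -, hX₁noeth, j₂, t₂, hsq₂, hcomm, -⟩ :=
    modelStep O k π hπ (Proj (homogeneousSubmodule (Fin (3 + 1)) O)) q ∅ (fun _ _ _ => True) (fun _ _ _ _ _ _ _ _ _ _ _ _ => trivial)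
      (Proj (homogeneousSubmodule (Fin (3 + 1)) O)) (𝟙 _) ((Proj.map φ hφ') '' Set.univ) trivial hPreg
      (Literature.AlgebraicGeometry.Motives.projectiveSpace 3 k).left (Proj.map φ hφ') _ hsq₀ Set.univ rfl
      𝓢 (vanishingIdeal (⟨S, hS⟩ : Closeds (Literature.AlgebraicGeometry.Motives.projectiveSpace 3 k).left)) h𝓢tr h𝓢reg hfl' hoff
      (Set.subset_univ _) X₁ τ hτ F₂ υ hυ
  haveI := hX₁noeth
  have hsq₂' : IsPullback j₂ t₂ (τ ≫ q) (Spec.map (CommRingCat.ofHom π)) := by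
    simpa only [Category.comp_id, Category.assoc] using hsq₂
  -- the slot's centre on `X₁` …
  obtain ⟨C, hCreg, hCfl, hCj, -⟩ := hC X₁ τ hτ F₂ υ hυ j₂ t₂ hsq₂' hcomm
  -- … is forbidden by the g6 no-go at the obstructed point of `Z̃₂`
  exact ModelSquare.not_exists_regular_flat_model_of_lt_spanFinrank O π hπ (τ ≫ q) j₂ t₂ hsq₂' (closure (υ ⁻¹' (Z \ S))) isClosed_closure
    (hedim F₂ υ hυ) ⟨C, hCreg, hCfl, hCj⟩

end Summit.ResolutionOfSingularities.ResolutionOfSingularities.Cruxes.EquisingularLiftNat.Sections.LiftNose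

end
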